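import Summits.HodgeConjecture.HodgeConjecture.Theorems.R90S6TwistedPolarity   -- ★ W9 `transpose_map_mul_antidiagonal_mul_qsInvolution` (`ᵗ(σγ)·J₀·Θ_σ(γ) = J₀`; brings ★ `UnitaryGroup.qsInvolution`, `StdForm`)
import HarnessLib

/-!
# R90 · S6 «Ch. 14.1–14.5 stable trace formula» — card K4: `κ̃` IS A CLASS FUNCTION — THE DETERMINANT ALGEBRA UNDER L4's SELECTION
# (`Theorems/R90S6TwistedKappaClassFunction.lean`)

Row E1.4.4.2.4 («constancy of `κ̃` on `T`-orbits ∕ relation `κ̃ ↔ κ` through Prop. 3.13.1»), dealer R90-C14-plan (g2), card K4 2026-09-05T01:21:30Z,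
built ahead in the generic letters of ★ L4 (`Theorems/R90S6TwistedKappaOrbitalSign`, R90-C14-p04) and ★ K3 (`Theorems/R90S6UnramifiedNormParity`): any field
`K` with a ring endomorphism `σ`, `Θ_σ = UnitaryGroup.qsInvolution σ` (`Θ_σ(g) = w⁰ ᵗ(σg)⁻¹ w⁰`), determinants read in `K` on the underlying matrices.

* §1 `det_coe_qsInvolution` — `det Θ_σ(g) = (σ det g)⁻¹` (from ★ W9 `ᵗ(σg)·J₀·Θ_σ(g) = J₀`: `σ(det g)·det J₀·det Θ_σ(g) = det J₀`, `det J₀ ≠ 0`; no sign survives),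
  and **`det_coe_inv_mul_mul_qsInvolution`** — `det(g⁻¹·δ·Θ_σ g) = det δ · (det g · σ det g)⁻¹`.
* §2 **`exists_det_twistedConj_mul_inv_eq_mul_map`** — for the ε-CONJUGATE `δ′ = g⁻¹·δ·Θ_σ g`: `det(δ′·δ⁻¹) = w·σw` with `w = (det g)⁻¹ ≠ 0` — so K3's
  `ω(det(δ′δ⁻¹)) = 1` on the rational ε-class; `map_det_twistedConj_mul_inv` — it is `σ`-fixed (`σ` an involution).
* §3 **`isNorm_det_twistedConj_mul_inv_iff`** + `ite_isNorm_det_twistedConj_mul_inv_eq` — REPRESENTATIVE-INDEPENDENCE of K3's sign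
  `κ(d) = [det(d·δ⁻¹) ∈ N(E^×)] ? 1 : −1`: replacing `d` by an ε-conjugate `g⁻¹·d·Θ_σ g` multiplies `det(d·δ⁻¹)` by the norm `(det g)⁻¹·σ(det g)⁻¹`, and norms
  are a group.  Together with the ε-conjugation invariance of the twisted orbital integral (★ `R90.S4.epsOrbitalIntegral_map_cosetCongr_conj`) this makes every
  term `κ_i · Φ_ε(d_i, 1_{Kϖ^aK})` of ★ L4 `sum_negOnePow_mul_epsOrbitalIntegral_twistedShell` a function of the ε-class of `d_i`.
  (K4.4, the `H`-bridge through ★ `prop3131_holds`, is the next card.)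

Lane `--kind proof --supports stmt-HodgeConjecture-24833 --as helper`; THEOREMS ONLY (no definition, no instance, no notation, no named fact, no `sorry`).
Seat R90-C14-p08 (g0).  HONEST LABEL: determinant bookkeeping, count-neutral until E1.4.4.2.4 ∕ E1.4.4.3.1 consume it; HC_CM is proved only modulo the 7
printed citations (2 remaining named inputs: hLiu418 = stmt-HodgeConjecture-24832, h413 = stmt-HodgeConjecture-24833) until rung 0 closes.

## References
* [Rogawski1990] J. D. Rogawski, *Automorphic Representations of Unitary Groups in Three Variables* (1990): §3.12 Prop. 3.12.1, §3.13 Prop. 3.13.1 (b),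
  §4.10 (4.10.1)–(4.10.3) p. 57–58.
* [Kottwitz1986BaseChangeUnits] R. E. Kottwitz, *Base change for unit elements of Hecke algebras*, Compositio Math. 60 (1986): §1 p. 243.
-/

set_option autoImplicit false
-- the mandated namespace repeats the single-problem summit's segment (`HodgeConjecture.HodgeConjecture`)
set_option linter.dupNamespace false

noncomputable section

open scoped Matrix MatrixGroups
open Literature.NumberTheory.Automorphic Literature.NumberTheory.Automorphic.HermitianLattice

namespace Summit.HodgeConjecture.HodgeConjecture.R90.S6

variable {K : Type*} [Field K] {σ : K →+* K} {N : ℕ}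

/-! ## §1 Determinants of `Θ_σ(g)` and of the twisted conjugate -/

/-- **`det Θ_σ(g) = (σ det g)⁻¹`** — from ★ `ᵗ(σg)·J₀·Θ_σ(g) = J₀` by taking determinants (`det ᵗ(σg) = σ(det g)` via `RingHom.map_det`, `det J₀ ≠ 0`).
[cite: Rogawski1990, §1.9 p. 8 («`det(σ(x)) = \overline{det(x)}⁻¹`»)] -/
theorem det_coe_qsInvolution (g : GL (Fin N) K) :
    ((UnitaryGroup.qsInvolution σ g : GL (Fin N) K) : Matrix (Fin N) (Fin N) K).det = (σ ((g : Matrix (Fin N) (Fin N) K).det))⁻¹ := by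
  have h := congrArg Matrix.det (transpose_map_mul_antidiagonal_mul_qsInvolution (σ := σ) g)
  rw [Matrix.det_mul, Matrix.det_mul, Matrix.det_transpose, ← RingHom.mapMatrix_apply, ← RingHom.map_det] at h
  have hJ : ((StdForm.antidiagonal N).over K).det ≠ 0 := ((Matrix.isUnit_iff_isUnit_det _).1 ((StdForm.antidiagonal N).isUnit_over K)).ne_zero
  have hσg : σ ((g : Matrix (Fin N) (Fin N) K).det) ≠ 0 :=
    (map_ne_zero σ).2 (Matrix.isUnits_det_units g).ne_zero
  -- `σ(det g) · det J₀ · det Θg = det J₀` ⇒ `σ(det g) · det Θg = 1`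
  have h1 : σ ((g : Matrix (Fin N) (Fin N) K).det) * ((UnitaryGroup.qsInvolution σ g : GL (Fin N) K) : Matrix (Fin N) (Fin N) K).det = 1 := by
    have h' : σ ((g : Matrix (Fin N) (Fin N) K).det) * ((UnitaryGroup.qsInvolution σ g : GL (Fin N) K) : Matrix (Fin N) (Fin N) K).det *
        ((StdForm.antidiagonal N).over K).det = 1 * ((StdForm.antidiagonal N).over K).det := by
      rw [one_mul, mul_right_comm]; exact h
    exact mul_right_cancel₀ hJ h'
  exact eq_inv_of_mul_eq_one_right h1

/-- **K4 §1 — `det(g⁻¹·δ·Θ_σ g) = det δ · (det g · σ det g)⁻¹`** (any field, any `σ`). [cite: Rogawski1990, §3.12 Prop. 3.12.1 (b); §4.10 p. 57] -/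
theorem det_coe_inv_mul_mul_qsInvolution (g δ : GL (Fin N) K) :
    (((g⁻¹ * δ * UnitaryGroup.qsInvolution σ g : GL (Fin N) K)) : Matrix (Fin N) (Fin N) K).det =
      ((δ : GL (Fin N) K) : Matrix (Fin N) (Fin N) K).det *
        ((g : Matrix (Fin N) (Fin N) K).det * σ ((g : Matrix (Fin N) (Fin N) K).det))⁻¹ := by
  have hg : (((g⁻¹ : GL (Fin N) K)) : Matrix (Fin N) (Fin N) K).det = (((g : GL (Fin N) K) : Matrix (Fin N) (Fin N) K).det)⁻¹ :=
    eq_inv_of_mul_eq_one_left (by rw [← Matrix.det_mul, ← Units.val_mul, inv_mul_cancel, Units.val_one, Matrix.det_one])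
  rw [Units.val_mul, Units.val_mul, Matrix.det_mul, Matrix.det_mul, hg, det_coe_qsInvolution, mul_inv]
  ring

/-! ## §2 On the rational ε-class `det(δ′·δ⁻¹)` is a norm -/

/-- **K4 §2 — FOR AN ε-CONJUGATE `δ′ = g⁻¹·δ·Θ_σ g`, `det(δ′·δ⁻¹)` IS A NORM**: `det(δ′δ⁻¹) = w·σw` with `w = (det g)⁻¹ ≠ 0`.  Hence K3's
`ω(det(δ′δ⁻¹)) = 1` identically on the rational ε-class of `δ` (★ `ite_exists_eq_mul_map_eq_negOnePow_log`). [cite: Rogawski1990, §3.12 Prop. 3.12.1 (b); §4.10 (4.10.3)] -/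
theorem exists_det_twistedConj_mul_inv_eq_mul_map (g δ : GL (Fin N) K) :
    ∃ w : K, w ≠ 0 ∧ (((g⁻¹ * δ * UnitaryGroup.qsInvolution σ g * δ⁻¹ : GL (Fin N) K)) : Matrix (Fin N) (Fin N) K).det = w * σ w := by
  have hgd : ((g : GL (Fin N) K) : Matrix (Fin N) (Fin N) K).det ≠ 0 := (Matrix.isUnits_det_units g).ne_zero
  have hδd : ((δ : GL (Fin N) K) : Matrix (Fin N) (Fin N) K).det ≠ 0 := (Matrix.isUnits_det_units δ).ne_zero
  have hδ : (((δ⁻¹ : GL (Fin N) K)) : Matrix (Fin N) (Fin N) K).det = (((δ : GL (Fin N) K) : Matrix (Fin N) (Fin N) K).det)⁻¹ :=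
    eq_inv_of_mul_eq_one_left (by rw [← Matrix.det_mul, ← Units.val_mul, inv_mul_cancel, Units.val_one, Matrix.det_one])
  refine ⟨(((g : GL (Fin N) K) : Matrix (Fin N) (Fin N) K).det)⁻¹, inv_ne_zero hgd, ?_⟩
  rw [Units.val_mul, Matrix.det_mul, det_coe_inv_mul_mul_qsInvolution, hδ, map_inv₀, mul_inv]
  field_simp

/-- `det(δ′·δ⁻¹)` is `σ`-FIXED for an involution `σ` (it is the norm `w·σw`). [cite: Rogawski1990, §3.12 Prop. 3.12.1 (b)] -/
theorem map_det_twistedConj_mul_inv (hσσ : ∀ a, σ (σ a) = a) (g δ : GL (Fin N) K) :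
    σ (((g⁻¹ * δ * UnitaryGroup.qsInvolution σ g * δ⁻¹ : GL (Fin N) K)) : Matrix (Fin N) (Fin N) K).det =
      (((g⁻¹ * δ * UnitaryGroup.qsInvolution σ g * δ⁻¹ : GL (Fin N) K)) : Matrix (Fin N) (Fin N) K).det := by
  obtain ⟨w, -, hw⟩ := exists_det_twistedConj_mul_inv_eq_mul_map (σ := σ) g δ
  rw [hw, map_mul, hσσ, mul_comm]

/-! ## §3 Representative-independence of K3's sign `κ(d) = [det(d·δ⁻¹) ∈ N(E^×)] ? 1 : −1` -/

/-- **K4 §3 — «IS A NORM» IS CONSTANT ON ε-CLASSES**: `det((g⁻¹·d·Θ_σ g)·δ⁻¹) ∈ N ⟺ det(d·δ⁻¹) ∈ N` (`N = {w·σw : w ≠ 0}`), because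
`det((g⁻¹dΘg)δ⁻¹) = n · det(dδ⁻¹)` with `n = (det g·σ det g)⁻¹ = (det g)⁻¹·σ((det g)⁻¹)` a norm, and norms form a group. [cite: Rogawski1990, §3.12 Prop. 3.12.1 (b); §4.10 (4.10.3)] -/
theorem isNorm_det_twistedConj_mul_inv_iff (g d δ : GL (Fin N) K) :
    (∃ w : K, w ≠ 0 ∧ (((g⁻¹ * d * UnitaryGroup.qsInvolution σ g * δ⁻¹ : GL (Fin N) K)) : Matrix (Fin N) (Fin N) K).det = w * σ w) ↔
      ∃ w : K, w ≠ 0 ∧ (((d * δ⁻¹ : GL (Fin N) K)) : Matrix (Fin N) (Fin N) K).det = w * σ w := by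
  have hgd : ((g : GL (Fin N) K) : Matrix (Fin N) (Fin N) K).det ≠ 0 := (Matrix.isUnits_det_units g).ne_zero
  -- `det((g⁻¹dΘg)δ⁻¹) = (det g)⁻¹ σ((det g)⁻¹) · det(dδ⁻¹)`
  have key : (((g⁻¹ * d * UnitaryGroup.qsInvolution σ g * δ⁻¹ : GL (Fin N) K)) : Matrix (Fin N) (Fin N) K).det =
      (((g : GL (Fin N) K) : Matrix (Fin N) (Fin N) K).det)⁻¹ * σ ((((g : GL (Fin N) K) : Matrix (Fin N) (Fin N) K).det)⁻¹) *
        (((d * δ⁻¹ : GL (Fin N) K)) : Matrix (Fin N) (Fin N) K).det := by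
    rw [Units.val_mul, Matrix.det_mul, det_coe_inv_mul_mul_qsInvolution, Units.val_mul (d) (δ⁻¹), Matrix.det_mul, map_inv₀, mul_inv]
    ring
  constructor
  · rintro ⟨w, hw, e⟩
    refine ⟨w * ((g : GL (Fin N) K) : Matrix (Fin N) (Fin N) K).det, mul_ne_zero hw hgd, ?_⟩
    have hσg : σ ((g : Matrix (Fin N) (Fin N) K).det) ≠ 0 := (map_ne_zero σ).2 hgd
    rw [key] at e
    rw [map_mul]
    calc (((d * δ⁻¹ : GL (Fin N) K)) : Matrix (Fin N) (Fin N) K).det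
        = ((g : Matrix (Fin N) (Fin N) K).det * σ ((g : Matrix (Fin N) (Fin N) K).det)) *
            (((g : Matrix (Fin N) (Fin N) K).det)⁻¹ * σ (((g : Matrix (Fin N) (Fin N) K).det)⁻¹) *
              (((d * δ⁻¹ : GL (Fin N) K)) : Matrix (Fin N) (Fin N) K).det) := by
          rw [map_inv₀]; field_simp
      _ = w * (g : Matrix (Fin N) (Fin N) K).det * (σ w * σ ((g : Matrix (Fin N) (Fin N) K).det)) := by rw [e]; ring
  · rintro ⟨w, hw, e⟩
    refine ⟨w * (((g : GL (Fin N) K) : Matrix (Fin N) (Fin N) K).det)⁻¹, mul_ne_zero hw (inv_ne_zero hgd), ?_⟩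
    rw [key, e, map_mul, map_inv₀]
    ring

open Classical in
/-- **K4 §3 — K3's SIGN `κ` IS UNCHANGED UNDER ε-CONJUGATION OF THE REPRESENTATIVE**: with `κ(d) := [det(d·δ⁻¹) ∈ N(E^×)] ? 1 : −1 ∈ ℤˣ` (the `ite` of ★ K3
`ite_isNorm_det_eq_negOnePow_log_sub`), `κ(g⁻¹·d·Θ_σ g) = κ(d)`.  With the ε-conjugation invariance of `Φ_ε` (★ `R90.S4.epsOrbitalIntegral_map_cosetCongr_conj`) every
term of ★ L4's signed sum is a function of the ε-class of `d_i`. [cite: Rogawski1990, §4.10 (4.10.1)–(4.10.3) p. 57–58] -/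
theorem ite_isNorm_det_twistedConj_mul_inv_eq (g d δ : GL (Fin N) K) :
    (if ∃ w : K, w ≠ 0 ∧ (((g⁻¹ * d * UnitaryGroup.qsInvolution σ g * δ⁻¹ : GL (Fin N) K)) : Matrix (Fin N) (Fin N) K).det = w * σ w
      then (1 : ℤˣ) else -1) =
      (if ∃ w : K, w ≠ 0 ∧ (((d * δ⁻¹ : GL (Fin N) K)) : Matrix (Fin N) (Fin N) K).det = w * σ w then (1 : ℤˣ) else -1) := by
  by_cases h : ∃ w : K, w ≠ 0 ∧ (((d * δ⁻¹ : GL (Fin N) K)) : Matrix (Fin N) (Fin N) K).det = w * σ w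
  · rw [if_pos h, if_pos ((isNorm_det_twistedConj_mul_inv_iff g d δ).2 h)]
  · rw [if_neg h, if_neg (mt (isNorm_det_twistedConj_mul_inv_iff g d δ).1 h)]

end Summit.HodgeConjecture.HodgeConjecture.R90.S6

end
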